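import Summits.Langlands.Langlands.Theses.PhantomRMYoshida
import Literature.NumberTheory.DiophantineGeometry.AVIsogenySymmProofs
import Literature.AlgebraicGeometry.Motives.AbelianVarietyDegreeGrowth
import Literature.AlgebraicGeometry.Motives.AbelianVarietyPoincareCompleteReducibility
import HarnessLib

/-!
# Route PhantomRMYoshida — FaltingsFinitenessI (item stmt-Langlands-15084), line `Sketch`: the converse transfer

Helper file for the line `Sketch` of the crux `PhantomRMYoshida.FaltingsFinitenessI`
(item stmt-Langlands-15084, Faltings' Finiteness I over `ℚ`: for every abelian variety `A / ℚ` only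
finitely many `B / ℚ`, up to isomorphism, admit an isogeny `B → A`).  The line proves the crux from
the isogeny-kernel bound

  `∀ A, ∃ N, ∀ B, IsIsogenous B A → ∃ g : A ⟶ B, IsIsogeny g ∧ Hom.kerRank g ≤ N`

(Masser–Wüstholz).  This file supplies the off-path CONVERSE transfer, the registered stub
`stub_isogenyKernelBound_of_faltingsFinitenessI`: Finiteness I gives the bound, so that the transfer
of the line is an equivalence.  Given the finite family `C : Fin n → AbelianVariety ℚ` of
representatives for `A`, pick for each `i` with `C i` isogenous to `A` an isogeny `gᵢ : A → C i`
(isogeny is symmetric in characteristic `0`, `IsIsogenous.symm_of_charZero`, Mumford §19, Remark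
p. 169) and let `N` bound all `deg gᵢ = Hom.kerRank gᵢ`; for `B` isogenous to `A` with `e : B ≅ C i`
the composite `gᵢ ≫ e⁻¹ : A → B` is an isogeny of degree `deg gᵢ ≤ N`, because degrees are
multiplicative (`IsIsogeny.kerRank_comp`, Milne 1986 §8) and an isomorphism has degree `1`
(`kerRank_id`).

* `kerRank_hom_of_iso`, `kerRank_inv_of_iso`, `kerRank_comp_iso`, `kerRank_comp_inv_of_iso`,
  `kerRank_iso_comp` — isomorphisms have degree `1` and do not change degrees under composition;
* `isogenyKernelBound_of_faltingsFinitenessI` — the converse transfer under its descriptive name;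
* `stub_isogenyKernelBound_of_faltingsFinitenessI` — the registered stub, verbatim.

Pure-proof file, no definitions, no new named facts.
-/

set_option linter.dupNamespace false -- as in the sibling Theorems files: `Summit.Langlands.Langlands` is the mandated namespace (summit = sub-problem)

noncomputable section

open CategoryTheory
open Literature.AlgebraicGeometry.Motives
open Literature.AlgebraicGeometry.Motives.AbelianVariety

universe u

namespace Summit.Langlands.Langlands.Theorems.PhantomRMYoshida

/-! ### Isomorphisms have degree one -/

/-- For an isomorphism `e : B ≅ C` of abelian varieties, `deg e⁻¹ · deg e = 1`: degrees
(`Hom.kerRank`, the order of the kernel group scheme) are multiplicative along isogenies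
(`IsIsogeny.kerRank_comp`, Milne 1986 §8), isomorphisms are isogenies (`isIsogeny_hom_of_iso`)
and `deg 𝟙 = 1` (`kerRank_id`). [folklore] -/
theorem kerRank_inv_mul_kerRank_hom {K : Type u} [Field K] {B C : AbelianVariety K} (e : B ≅ C) :
    Hom.kerRank e.inv * Hom.kerRank e.hom = 1 := by
  have h := (isIsogeny_hom_of_iso e.symm).kerRank_comp (isIsogeny_hom_of_iso e)
  rw [Iso.symm_hom, e.inv_hom_id, kerRank_id] at h
  exact h.symm

/-- An isomorphism of abelian varieties has degree `1`: `Hom.kerRank e.hom = 1`. [folklore] -/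
theorem kerRank_hom_of_iso {K : Type u} [Field K] {B C : AbelianVariety K} (e : B ≅ C) :
    Hom.kerRank e.hom = 1 :=
  Nat.eq_one_of_mul_eq_one_left (kerRank_inv_mul_kerRank_hom e)

/-- The inverse of an isomorphism of abelian varieties has degree `1`: `Hom.kerRank e.inv = 1`.
[folklore] -/
theorem kerRank_inv_of_iso {K : Type u} [Field K] {B C : AbelianVariety K} (e : B ≅ C) :
    Hom.kerRank e.inv = 1 :=
  Nat.eq_one_of_mul_eq_one_right (kerRank_inv_mul_kerRank_hom e)

/-- Composing an isogeny with an isomorphism does not change its degree: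
`deg (f ≫ e) = deg f`. [folklore] -/
theorem kerRank_comp_iso {K : Type u} [Field K] {A B C : AbelianVariety K} {f : A ⟶ B}
    (hf : IsIsogeny f) (e : B ≅ C) : Hom.kerRank (f ≫ e.hom) = Hom.kerRank f := by
  rw [hf.kerRank_comp (isIsogeny_hom_of_iso e), kerRank_hom_of_iso, mul_one]

/-- Composing an isogeny with the inverse of an isomorphism does not change its degree:
`deg (f ≫ e⁻¹) = deg f`. [folklore] -/
theorem kerRank_comp_inv_of_iso {K : Type u} [Field K] {A B C : AbelianVariety K} {f : A ⟶ C}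
    (hf : IsIsogeny f) (e : B ≅ C) : Hom.kerRank (f ≫ e.inv) = Hom.kerRank f :=
  kerRank_comp_iso hf e.symm

/-- Precomposing an isogeny with an isomorphism does not change its degree:
`deg (e ≫ f) = deg f`. [folklore] -/
theorem kerRank_iso_comp {K : Type u} [Field K] {A B C : AbelianVariety K} (e : A ≅ B) {f : B ⟶ C}
    (hf : IsIsogeny f) : Hom.kerRank (e.hom ≫ f) = Hom.kerRank f := by
  rw [(isIsogeny_hom_of_iso e).kerRank_comp hf, kerRank_hom_of_iso, one_mul]

/-! ### The converse transfer -/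

/-- **Finiteness I over `ℚ` gives the isogeny-kernel bound** (the converse transfer of the line
`Sketch` of item stmt-Langlands-15084, descriptive name): if every `A / ℚ` has a finite family
`C : Fin n → AbelianVariety ℚ` containing, up to isomorphism, every `B` isogenous to `A`, then for
every `A` there is `N` such that every `B` isogenous to `A` is the target of an isogeny `A → B` of
degree `≤ N`.  Proof: for each `i` with `C i` isogenous to `A` choose an isogeny `gᵢ : A → C i`
(symmetry of isogeny in characteristic `0`, `IsIsogenous.symm_of_charZero`, Mumford §19, Remark
p. 169), put `N = sup_i deg gᵢ`, and transport `gᵢ` along `e : B ≅ C i`: `gᵢ ≫ e⁻¹` is an isogeny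
(`isIsogeny_comp`, `isIsogeny_hom_of_iso`) of degree `deg gᵢ` (`kerRank_comp_inv_of_iso`).
[folklore] -/
theorem isogenyKernelBound_of_faltingsFinitenessI
    (hFin : Summit.Langlands.Langlands.Theses.PhantomRMYoshida.FaltingsFinitenessI)
    (A : AbelianVariety ℚ) :
    ∃ N : ℕ, ∀ B : AbelianVariety ℚ, IsIsogenous B A →
      ∃ g : A ⟶ B, IsIsogeny g ∧ Hom.kerRank g ≤ N := by
  obtain ⟨n, C, hC⟩ := hFin A
  -- for each representative `C i`, a homomorphism `A → C i` that is an isogeny if `C i ∼ A`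
  have key : ∀ i : Fin n, ∃ g : A ⟶ C i, IsIsogenous (C i) A → IsIsogeny g := fun i => by
    by_cases h : IsIsogenous (C i) A
    · obtain ⟨g, hg⟩ := IsIsogenous.symm_of_charZero h
      exact ⟨g, fun _ => hg⟩
    · exact ⟨0, fun h' => absurd h' h⟩
  choose g hg using key
  refine ⟨Finset.univ.sup fun i => Hom.kerRank (g i), fun B hB => ?_⟩
  -- `B ≅ C i` for some representative, which is then isogenous to `A`
  obtain ⟨i, ⟨e⟩⟩ := hC B hB
  have hi : IsIsogenous (C i) A :=
    hB.elim fun f hf => ⟨e.inv ≫ f, isIsogeny_comp (isIsogeny_hom_of_iso e.symm) hf⟩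
  refine ⟨g i ≫ e.inv, isIsogeny_comp (hg i hi) (isIsogeny_hom_of_iso e.symm), ?_⟩
  rw [kerRank_comp_inv_of_iso (hg i hi) e]
  exact Finset.le_sup (f := fun i => Hom.kerRank (g i)) (Finset.mem_univ i)

/-- **Finiteness I over `ℚ` gives the isogeny-kernel bound** (registered stub of the line `Sketch`
of item stmt-Langlands-15084, verbatim; the off-path converse making the line's transfer an
equivalence): one isogeny `A → C i` per representative (isogeny is symmetric in characteristic `0`,
`IsIsogenous.symm_of_charZero`), transported along `B ≅ C i`; see
`isogenyKernelBound_of_faltingsFinitenessI`. [folklore] -/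
theorem stub_isogenyKernelBound_of_faltingsFinitenessI
    (hFin : Summit.Langlands.Langlands.Theses.PhantomRMYoshida.FaltingsFinitenessI) :
    ∀ A : AbelianVariety ℚ, ∃ N : ℕ, ∀ B : AbelianVariety ℚ, IsIsogenous B A →
      ∃ g : A ⟶ B, IsIsogeny g ∧ Hom.kerRank g ≤ N :=
  isogenyKernelBound_of_faltingsFinitenessI hFin

end Summit.Langlands.Langlands.Theorems.PhantomRMYoshida

end
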